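import Mathlib
import HarnessLib

/-!
# Route MonotoneRestoration — aside `OrbitCompressionQP` (stmt-ValiantsHypothesis-18332): AVERAGING OVER A
# POINTWISE STABILISER = SUMMING OVER INJECTIVE LABEL ASSIGNMENTS

The counting lemma behind the REYNOLDS step of the extraction half (S1b′) of the repaired
`stub_orbitToNarrowExpression` (evidence `S1b-plan.md` on the item): if `q = Σ_l c_l u_l` is fixed by the
pointwise stabiliser `G_X` of a set `X` of indices and each `u_l` is the value of a labelled expression at an
assignment `λ_l`, then `q = |G_X|⁻¹ Σ_{ρ ∈ G_X} Σ_l c_l val(e_l; ρ ∘ λ_l)` (equivariance), and for each `l` the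
inner sum over the GROUP is a positive multiple of the sum over all INJECTIVE assignments avoiding `X` —
which the peeling lemma then rewrites with free sums (`sumLabel`) and label identifications.

* `exists_perm_fixing_extend` — two injective assignments avoiding `X` differ by a permutation fixing
  `X` pointwise (`Equiv.Perm.exists_extending_pair`);
* `card_fiber_eq` — all fibres of `ρ ↦ ρ ∘ λ` on `G_X` over injective `X`-avoiding assignments have the
  same size;
* `sum_stabiliser_comp_eq_smul_sum_injective` — **`Σ_{ρ ∈ G_X} F(ρ ∘ λ) = N • Σ_{g injective, avoiding X} F g`
  for some `N ≥ 1`** (independent of `F`), for every injective `X`-avoiding `λ`.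

Helper file (`--supports stmt-ValiantsHypothesis-18332`); def-free; nothing here is a named fact.
-/

-- `Summit.ValiantsHypothesis.ValiantsHypothesis.…` is the tree's single-conjunct layout (Sub = Summit).
set_option linter.dupNamespace false

namespace Summit.ValiantsHypothesis.ValiantsHypothesis.Theorems

namespace OrbitSupport

open scoped Classical

variable {n : ℕ}

/-- **Two injective assignments avoiding `X` differ by a permutation fixing `X` pointwise.** [folklore] -/
theorem exists_perm_fixing_extend {ι : Type*} [Finite ι] (X : Finset (Fin n)) (f g : ι → Fin n)
    (hf : Function.Injective f) (hg : Function.Injective g) (hfX : ∀ a, f a ∉ X) (hgX : ∀ a, g a ∉ X) :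
    ∃ τ : Equiv.Perm (Fin n), (∀ x ∈ X, τ x = x) ∧ ∀ a, τ (f a) = g a := by
  -- extend the pair (inclusion of `X`, `f`) / (inclusion of `X`, `g`)
  let x : X ⊕ ι → Fin n := Sum.elim (fun z => z.1) f
  let y : X ⊕ ι → Fin n := Sum.elim (fun z => z.1) g
  have hx : Function.Injective x := by
    rintro (z | a) (z' | a') h
    · exact congrArg Sum.inl (Subtype.ext h)
    · exact absurd z.2 (by change (x (Sum.inl z)) ∈ X → False; rw [h]; exact hfX a')
    · exact absurd z'.2 (by change (x (Sum.inl z')) ∈ X → False; rw [← h]; exact hfX a)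
    · exact congrArg Sum.inr (hf h)
  have hy : Function.Injective y := by
    rintro (z | a) (z' | a') h
    · exact congrArg Sum.inl (Subtype.ext h)
    · exact absurd z.2 (by change (y (Sum.inl z)) ∈ X → False; rw [h]; exact hgX a')
    · exact absurd z'.2 (by change (y (Sum.inl z')) ∈ X → False; rw [← h]; exact hgX a)
    · exact congrArg Sum.inr (hg h)
  obtain ⟨τ, hτ⟩ := Equiv.Perm.exists_extending_pair x y hx hy
  exact ⟨τ, fun z hz => hτ (Sum.inl ⟨z, hz⟩), fun a => hτ (Sum.inr a)⟩

/-- **All fibres of `ρ ↦ ρ ∘ λ` on the pointwise stabiliser of `X`, over injective `X`-avoiding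
assignments, have the same size** (left translation by a permutation fixing `X` carrying one assignment to
the other). [folklore] -/
theorem card_fiber_eq {ι : Type*} [Fintype ι] (X : Finset (Fin n)) (lam g : ι → Fin n)
    (hlam : Function.Injective lam) (hlamX : ∀ a, lam a ∉ X) (hg : Function.Injective g)
    (hgX : ∀ a, g a ∉ X) :
    ((Finset.univ.filter fun ρ : Equiv.Perm (Fin n) => ∀ x ∈ X, ρ x = x).filter
        fun ρ : Equiv.Perm (Fin n) => ⇑ρ ∘ lam = g).card =
      ((Finset.univ.filter fun ρ : Equiv.Perm (Fin n) => ∀ x ∈ X, ρ x = x).filter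
        fun ρ : Equiv.Perm (Fin n) => ⇑ρ ∘ lam = lam).card := by
  obtain ⟨τ, hτX, hτ⟩ := exists_perm_fixing_extend X lam g hlam hg hlamX hgX
  refine Finset.card_bij (fun ρ _ => τ⁻¹ * ρ) (fun ρ hρ => ?_) (fun ρ _ ρ' _ h => mul_left_cancel h)
    (fun ρ' hρ' => ⟨τ * ρ', ?_, by rw [← mul_assoc, inv_mul_cancel, one_mul]⟩)
  · simp only [Finset.mem_filter, Finset.mem_univ, true_and] at hρ ⊢
    refine ⟨fun z hz => ?_, funext fun a => ?_⟩
    · rw [Equiv.Perm.mul_apply, hρ.1 z hz, Equiv.Perm.inv_eq_iff_eq, hτX z hz]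
    · have := congrFun hρ.2 a
      simp only [Function.comp_apply] at this ⊢
      rw [Equiv.Perm.mul_apply, this, Equiv.Perm.inv_eq_iff_eq, hτ a]
  · simp only [Finset.mem_filter, Finset.mem_univ, true_and] at hρ' ⊢
    refine ⟨fun z hz => ?_, funext fun a => ?_⟩
    · rw [Equiv.Perm.mul_apply, hρ'.1 z hz, hτX z hz]
    · have := congrFun hρ'.2 a
      simp only [Function.comp_apply] at this ⊢
      rw [Equiv.Perm.mul_apply, this, hτ a]

/-- **AVERAGING OVER THE POINTWISE STABILISER IS SUMMING OVER INJECTIVE ASSIGNMENTS.**  For an injective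
assignment `λ : ι → [n]` avoiding `X` and any `F` on assignments with values in an additive commutative
monoid: `Σ_{ρ fixing X pointwise} F(ρ ∘ λ) = N • Σ_{g injective, avoiding X} F(g)` with `N ≥ 1` the common
fibre size (independent of `F`). [folklore] -/
theorem sum_stabiliser_comp_eq_smul_sum_injective {ι : Type*} [Fintype ι] (X : Finset (Fin n))
    (lam : ι → Fin n) (hlam : Function.Injective lam) (hlamX : ∀ a, lam a ∉ X) :
    ∃ N : ℕ, 0 < N ∧ ∀ {M : Type*} [AddCommMonoid M] (F : (ι → Fin n) → M),
      ∑ ρ ∈ Finset.univ.filter (fun ρ : Equiv.Perm (Fin n) => ∀ x ∈ X, ρ x = x), F (⇑ρ ∘ lam) =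
        N • ∑ g ∈ Finset.univ.filter (fun g : ι → Fin n => Function.Injective g ∧ ∀ a, g a ∉ X), F g := by
  set G := Finset.univ.filter (fun ρ : Equiv.Perm (Fin n) => ∀ x ∈ X, ρ x = x) with hG
  set Inj := Finset.univ.filter (fun g : ι → Fin n => Function.Injective g ∧ ∀ a, g a ∉ X) with hInj
  set N := (G.filter fun ρ : Equiv.Perm (Fin n) => ⇑ρ ∘ lam = lam).card with hN
  have hN0 : 0 < N := Finset.card_pos.2 ⟨1, by simp [hG]⟩
  refine ⟨N, hN0, fun {M} _ F => ?_⟩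
  -- `ρ ∘ λ` is injective and avoids `X`
  have hmaps : ∀ ρ ∈ G, (⇑ρ ∘ lam) ∈ Inj := by
    intro ρ hρ
    simp only [hG, hInj, Finset.mem_filter, Finset.mem_univ, true_and] at hρ ⊢
    refine ⟨ρ.injective.comp hlam, fun a ha => hlamX a ?_⟩
    change ρ (lam a) ∈ X at ha
    have hfix : ρ (ρ (lam a)) = ρ (lam a) := hρ _ ha
    have h2 : ρ (lam a) = lam a := ρ.injective hfix
    rwa [h2] at ha
  rw [← Finset.sum_fiberwise_of_maps_to hmaps, Finset.smul_sum]
  refine Finset.sum_congr rfl fun g hg => ?_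
  have hg' : Function.Injective g ∧ ∀ a, g a ∉ X := by
    simpa [hInj] using hg
  have hrew : ∑ ρ ∈ G.filter (fun ρ : Equiv.Perm (Fin n) => ⇑ρ ∘ lam = g), F (⇑ρ ∘ lam) =
      ∑ ρ ∈ G.filter (fun ρ : Equiv.Perm (Fin n) => ⇑ρ ∘ lam = g), F g :=
    Finset.sum_congr rfl fun ρ hρ => by rw [(Finset.mem_filter.1 hρ).2]
  rw [hrew, Finset.sum_const, hN, ← card_fiber_eq X lam g hlam hlamX hg'.1 hg'.2]

end OrbitSupport

end Summit.ValiantsHypothesis.ValiantsHypothesis.Theorems
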